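import Literature.Barriers.HodgeConjecture.IntegralCoefficientsSupport
import Literature.Barriers.HodgeConjecture.IntegralCoefficientsKollarProofs
import HarnessLib

/-!
# Kollár (1992): the kernel bound (i) reduces to irreducible curves

Sibling of `Literature/Barriers/HodgeConjecture/IntegralCoefficients` (D-0021 catalogue) and of
`…IntegralCoefficientsKollarProofs`, whose reduction theorems for the barrier fact
`Kollar1992_nonTorsionClass_notAlgebraic` (`…_of_ker_le_span` and its descendants) carry the
hypothesis

(i) for EVERY Zariski-closed `Z ⊆ X` all of whose points have codimension `≥ 2` in the smooth
projective threefold `X`, `ker (H⁴(X(ℂ); ℤ) → H⁴((X ∖ Z)(ℂ); ℤ)) ≤ ℤ · (p • α)`,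

standing for the two deep inputs of the printed proof [Soulé–Voisin 2005, §2]: "`H⁴(X, ℤ) = ℤα`"
with the class of a curve `C` being `(deg C) α` (integral Lefschetz and purity), and Kollár's
"for general `X`, any curve `C ⊂ X` has degree divisible by `p`" [Soulé–Voisin 2005, Thm. 2;
Kollár 1992, §1 Lemma p. 134]. Both inputs speak about (irreducible) CURVES; a general `Z` as in
(i) is a finite union of irreducible curves and closed points meeting in finitely many closed points
(`X` is Noetherian, Hartshorne I Prop. 1.5; `dim + codim = 3`, Hartshorne II Ex. 3.20 (d)). This
file proves that (i) follows from its restriction to IRREDUCIBLE CURVES,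

(i') for every irreducible closed `C ⊆ X` of dimension `1` (all points of codimension `≥ 2`, some
point of codimension `2`), `ker (H⁴(X(ℂ); ℤ) → H⁴((X ∖ C)(ℂ); ℤ)) ≤ ℤ · (p • α)`,

by the `ℤ`-coefficient support calculus of `…IntegralCoefficientsSupport` (closed points carry no
class of degree `4`: `ker_restrictComplInt_eq_bot_of_finite`; supports add over closed sets meeting
in finitely many points: `ker_restrictComplInt_union_eq_sup`) and Noetherian induction over the
irreducible components of `Z` (`ker_restrictComplInt_le_of_forall_isIrreducible`, stated for a
smooth projective `X` of any dimension `r + 1` and closed subsets of dimension `≤ 1`). Whence the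
assembly `Kollar1992_nonTorsionClass_notAlgebraic_of_ker_le_span_of_curves`: the lattice step of
`…KollarProofs` with (i) replaced by (i'). What remains hypothetical is exactly the printed content
of (i') — purity for ONE irreducible curve (`ker = ℤ · cl(C)`, `cl(C) = (deg C) α`, Fulton 1998
§19.1 Lemma 19.1.1 with the integral Lefschetz theorem) and Kollár's divisibility `p ∣ deg C`.

Everything is proved; no named facts.

## References

* [SouleVoisin2005] C. Soulé, C. Voisin, Adv. Math. 198 (2005), §2 and Thm. 2.
* [KollarTrento1992] J. Kollár, Trento examples §1, Lemma p. 134 and Example p. 135, LNM 1515.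
* [Fulton1998] W. Fulton, Intersection Theory, §19.1 Lemma 19.1.1.
* [Hartshorne1977] R. Hartshorne, Algebraic Geometry, I Prop. 1.5, II Ex. 2.9, II Ex. 3.20 (d).
* [GrothendieckTopology1969] A. Grothendieck, Topology 8 (1969), §1.
-/

noncomputable section

open CategoryTheory AlgebraicGeometry Set Topology
open Literature.AlgebraicTopology.SingularHomology Literature.AlgebraicGeometry.Motives

namespace Literature.Barriers.HodgeConjecture

section Barriers
section HodgeConjecture

variable {X : SchemeOver ℂ}

/-- **One irreducible closed subset of dimension `≤ 1`.** On a smooth projective `X` of dimension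
`r + 1`, let `C ⊆ X` be closed irreducible with all points of codimension `≥ r`. If `C` has a
point of codimension `r` (a curve), the bound `ker_C ≤ S` is the hypothesis; otherwise all points of
`C` have codimension `≥ r + 1`, so `C` is a finite set of closed points and `ker_C = 0` in degrees
`2 ≤ k ≠ 2 (r + 1)` (`ker_restrictComplInt_eq_bot_of_finite`).
[cite: GrothendieckTopology1969, §1] [cite: Hartshorne1977, II Ex. 3.20 (d)] -/
theorem ker_restrictComplInt_le_of_isIrreducible {r : ℕ} (hX : IsSmoothProjective (r + 1) X)
    {k : ℕ} (hk : 2 ≤ k) (hkn : k ≠ 2 * (r + 1)) {S : Submodule ℤ (bettiCohomologyInt X k)}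
    (h : ∀ C : Set X.left, IsClosed C → IsIrreducible C →
      (∀ z ∈ C, (r : ℕ∞) ≤ Order.coheight z) → (∃ z ∈ C, Order.coheight z = r) →
        LinearMap.ker (restrictComplInt X C k).hom ≤ S)
    {C : Set X.left} (hC : IsIrreducible C) (hCc : IsClosed C)
    (hCr : ∀ z ∈ C, (r : ℕ∞) ≤ Order.coheight z) :
    LinearMap.ker (restrictComplInt X C k).hom ≤ S := by
  by_cases hcurve : ∃ z ∈ C, Order.coheight z = r
  · exact h C hCc hC hCr hcurve
  · push Not at hcurve
    have hC' : ∀ z ∈ C, ((r + 1 : ℕ) : ℕ∞) ≤ Order.coheight z := fun z hz ↦ by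
      have h3 : (r : ℕ∞) < Order.coheight z := lt_of_le_of_ne (hCr z hz) (hcurve z hz).symm
      calc ((r + 1 : ℕ) : ℕ∞) = (r : ℕ∞) + 1 := by push_cast; rfl
        _ ≤ Order.coheight z := Order.add_one_le_of_lt h3
    rw [ker_restrictComplInt_eq_bot_of_finite hX (by omega)
      (finite_of_isClosed_of_le_coheight hX hCc hC') hk hkn]
    exact bot_le

/-- **The kernel bound reduces to irreducible curves.** Let `X` be smooth projective of dimension
`r + 1` over `ℂ`, `2 ≤ k` with `k, k + 1 ≠ 2 (r + 1)`, and `S ⊆ Hᵏ(X(ℂ); ℤ)` a subgroup. If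
`ker (Hᵏ(X(ℂ);ℤ) → Hᵏ((X ∖ C)(ℂ);ℤ)) ≤ S` for every IRREDUCIBLE closed `C ⊆ X` of dimension `1`
(all points of codimension `≥ r`, some point of codimension `r`), then the same holds for every
closed `Z ⊆ X` all of whose points have codimension `≥ r`. Proof: `Z` is the union of finitely
many irreducible closed subsets (`X` Noetherian, Hartshorne I Prop. 1.5); peel them off one at a
time — a component contained in the rest changes nothing, otherwise it meets the rest in a closed
subset missing its generic point, hence in finitely many closed points (Hartshorne II Ex. 3.20 (d)),
and supports add (`ker_restrictComplInt_union_eq_sup`, Mayer–Vietoris on `X(ℂ)`); components which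
are points contribute nothing (`ker_restrictComplInt_le_of_isIrreducible`). For `r = 2`, `k = 4`
this turns hypothesis (i) of `Kollar1992_nonTorsionClass_notAlgebraic_of_ker_le_span` into a
statement about irreducible curves only, the setting of [cite: SouleVoisin2005, §2 Thm. 2] and
[cite: KollarTrento1992, §1 Lemma p. 134]. [cite: Hartshorne1977, I Prop. 1.5 and II Ex. 3.20 (d)]
[cite: GrothendieckTopology1969, §1] -/
theorem ker_restrictComplInt_le_of_forall_isIrreducible {r : ℕ} (hX : IsSmoothProjective (r + 1) X)
    {k : ℕ} (hk : 2 ≤ k) (hkn : k ≠ 2 * (r + 1)) (hkn' : k + 1 ≠ 2 * (r + 1))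
    {S : Submodule ℤ (bettiCohomologyInt X k)}
    (h : ∀ C : Set X.left, IsClosed C → IsIrreducible C →
      (∀ z ∈ C, (r : ℕ∞) ≤ Order.coheight z) → (∃ z ∈ C, Order.coheight z = r) →
        LinearMap.ker (restrictComplInt X C k).hom ≤ S)
    {Z : Set X.left} (hZ : IsClosed Z) (hZr : ∀ z ∈ Z, (r : ℕ∞) ≤ Order.coheight z) :
    LinearMap.ker (restrictComplInt X Z k).hom ≤ S := by
  classical
  haveI : IsLocallyNoetherian X.left := IsSmoothProjective.isLocallyNoetherian_holds hX
  haveI : CompactSpace X.left := IsSmoothProjective.compactSpace_holds hX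
  haveI : IsNoetherian X.left := {}
  obtain ⟨𝒮, h𝒮, hZ𝒮⟩ := TopologicalSpace.NoetherianSpace.exists_finset_irreducible
    (⟨Z, hZ⟩ : TopologicalSpace.Closeds X.left)
  have hZeq : Z = ⋃ C ∈ 𝒮, (C : Set X.left) := by
    have h1 := congrArg (fun s : TopologicalSpace.Closeds X.left ↦ (s : Set X.left)) hZ𝒮
    simpa [Finset.sup_set_eq_biUnion] using h1
  have hsub : ∀ C ∈ 𝒮, (C : Set X.left) ⊆ Z := fun C hC z hz ↦ by
    rw [hZeq]
    exact mem_biUnion hC hz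
  suffices key : ∀ T : Finset (TopologicalSpace.Closeds X.left), T ⊆ 𝒮 →
      LinearMap.ker (restrictComplInt X (⋃ C ∈ T, (C : Set X.left)) k).hom ≤ S by
    have hkey := key 𝒮 subset_rfl
    rwa [← hZeq] at hkey
  intro T
  induction T using Finset.induction_on with
  | empty =>
    intro
    have h0 : (⋃ C ∈ (∅ : Finset (TopologicalSpace.Closeds X.left)), (C : Set X.left)) = ∅ := by
      ext z
      simp
    rw [h0, ker_restrictComplInt_empty]
    exact bot_le
  | @insert C T hCT ih =>
    intro hins
    have hC𝒮 : C ∈ 𝒮 := hins (Finset.mem_insert_self C T)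
    have hT𝒮 : T ⊆ 𝒮 := fun D hD ↦ hins (Finset.mem_insert_of_mem hD)
    have hCirr : IsIrreducible (C : Set X.left) := h𝒮 ⟨C, hC𝒮⟩
    have hCr : ∀ z ∈ (C : Set X.left), (r : ℕ∞) ≤ Order.coheight z :=
      fun z hz ↦ hZr z (hsub C hC𝒮 hz)
    have hTc : IsClosed (⋃ D ∈ T, (D : Set X.left)) :=
      isClosed_biUnion_finset fun D _ ↦ D.isClosed
    rw [Finset.set_biUnion_insert]
    by_cases hgen : hCirr.genericPoint ∈ ⋃ D ∈ T, (D : Set X.left)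
    · -- `C = closure {η} ⊆ ⋃ T`: nothing new
      have hCsub : (C : Set X.left) ⊆ ⋃ D ∈ T, (D : Set X.left) := by
        rw [← (hCirr.isGenericPoint_genericPoint C.isClosed).def]
        exact closure_minimal (singleton_subset_iff.mpr hgen) hTc
      rw [union_eq_self_of_subset_left hCsub]
      exact ih hT𝒮
    · -- `C` meets the rest in a closed subset missing its generic point: finitely many points
      have hfin : ((C : Set X.left) ∩ ⋃ D ∈ T, (D : Set X.left)).Finite :=
        finite_of_isClosed_of_genericPoint_notMem hX hCirr C.isClosed hCr (C.isClosed.inter hTc)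
          inter_subset_left fun hmem ↦ hgen hmem.2
      rw [ker_restrictComplInt_union_eq_sup hX (by omega) C.isClosed hTc hfin (by omega) hkn']
      exact sup_le (ker_restrictComplInt_le_of_isIrreducible hX hk hkn h hCirr C.isClosed hCr)
        (ih hT𝒮)

/-- **`Nʳ Hᵏ(X(ℂ); ℤ)` is generated by the classes supported on IRREDUCIBLE CURVES** (`X` smooth
projective of dimension `r + 1`, `2 ≤ k`, `k, k + 1 ≠ 2 (r + 1)`): the support filtration step
`integralSupportedClasses X k r` (kernels over all closed `Z` of codimension `≥ r`, i.e. of dimension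
`≤ 1`) equals the supremum of the kernels over the irreducible closed curves `C` (all points of
codimension `≥ r`, some point of codimension `r`) — closed points carry nothing and supports add
(`ker_restrictComplInt_le_of_forall_isIrreducible`). [cite: GrothendieckTopology1969, §1]
[cite: Hartshorne1977, I Prop. 1.5 and II Ex. 3.20 (d)] -/
theorem integralSupportedClasses_eq_iSup_isIrreducible {r : ℕ} (hX : IsSmoothProjective (r + 1) X)
    {k : ℕ} (hk : 2 ≤ k) (hkn : k ≠ 2 * (r + 1)) (hkn' : k + 1 ≠ 2 * (r + 1)) :
    integralSupportedClasses X k r =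
      ⨆ (C : Set X.left) (_ : IsClosed C) (_ : IsIrreducible C)
        (_ : ∀ z ∈ C, (r : ℕ∞) ≤ Order.coheight z) (_ : ∃ z ∈ C, Order.coheight z = r),
        LinearMap.ker (restrictComplInt X C k).hom := by
  refine le_antisymm ?_ ?_
  · refine iSup_le fun Z ↦ iSup_le fun hZ ↦ iSup_le fun hZr ↦ ?_
    refine ker_restrictComplInt_le_of_forall_isIrreducible hX hk hkn hkn' ?_ hZ hZr
    intro C hC hCi hCr hCx
    exact le_iSup_of_le C (le_iSup_of_le hC (le_iSup_of_le hCi (le_iSup_of_le hCr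
      (le_iSup_of_le hCx le_rfl))))
  · refine iSup_le fun C ↦ iSup_le fun hC ↦ iSup_le fun _ ↦ iSup_le fun hCr ↦ iSup_le fun _ ↦ ?_
    exact le_iSup_of_le C (le_iSup_of_le hC (le_iSup_of_le hCr le_rfl))

variable (X) in
/-- **On a smooth projective threefold, the integral algebraic classes of codimension `2` are
generated by classes supported on irreducible curves**: `integralAlgebraicClasses X 2 =
N² H⁴(X(ℂ); ℤ) = ⨆_C ker (H⁴(X(ℂ);ℤ) → H⁴((X ∖ C)(ℂ);ℤ))` over the irreducible closed curves
`C ⊆ X` — the form in which "`α` is not the class of an algebraic cycle with integral coefficients"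
is argued in print (every curve `C ⊂ X` has class `(deg C) α` with `p ∣ deg C`).
[cite: SouleVoisin2005, §2 Thm. 2] [cite: KollarTrento1992, §1 Lemma p. 134]
[cite: GrothendieckTopology1969, §1] -/
theorem integralAlgebraicClasses_two_eq_iSup_curves (hX : IsSmoothProjective 3 X) :
    integralAlgebraicClasses X 2 =
      ⨆ (C : Set X.left) (_ : IsClosed C) (_ : IsIrreducible C)
        (_ : ∀ z ∈ C, ((2 : ℕ) : ℕ∞) ≤ Order.coheight z) (_ : ∃ z ∈ C, Order.coheight z = (2 : ℕ)),
        LinearMap.ker (restrictComplInt X C (2 * 2)).hom :=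
  integralSupportedClasses_eq_iSup_isIrreducible (r := 2) hX (by norm_num) (by norm_num) (by norm_num)

/-! ### Unique extension of classes across finitely many points -/

/-- **`Hᵏ(X(ℂ); ℤ) → Hᵏ((X ∖ S)(ℂ); ℤ)` is bijective for `S` finite and `2 ≤ k ≤ 2 dim X - 2`**
(`X` smooth projective of dimension `n ≥ 1`; precisely `2 ≤ k`, `k ≠ 2n`, `k + 1 ≠ 2n`): classes on
the complement of finitely many closed points extend uniquely to `X(ℂ)` (the local cohomology of a
finite set in the `2n`-manifold `X(ℂ)` is concentrated in degree `2n`; Hatcher 2002, §3.3 p. 231;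
the tree's `map_inclusion_{injective,surjective}_of_finite_diff`). This is what lets a class
supported on the smooth locus `C ∖ Sing C` of a curve, formed in `(X ∖ Sing C)(ℂ)`, be read in
`H⁴(X(ℂ); ℤ)`. [cite: HatcherAT2002, §3.3 p. 231 and §3.1 pp. 203–204] -/
theorem restrictComplInt_bijective_of_finite {n : ℕ} (hX : IsSmoothProjective n X) (hn : 1 ≤ n)
    {S : Set X.left} (hS : S.Finite) {k : ℕ} (hk : 2 ≤ k) (hkn : k ≠ 2 * n)
    (hkn' : k + 1 ≠ 2 * n) : Function.Bijective (restrictComplInt X S k) := by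
  refine ⟨?_, ?_⟩
  · rw [← LinearMap.ker_eq_bot (f := (restrictComplInt X S k).hom)]
    exact ker_restrictComplInt_eq_bot_of_finite hX hn hS hk hkn
  · haveI := hX.smoothOfRelativeDimension
    haveI : Smooth X.hom := SmoothOfRelativeDimension.smooth n X.hom
    letI := hX.chartedSpace
    haveI := ComplexPoints.t2Space_of_isSmoothProjective hX
    let V : Set (ComplexPoints X) := {P | P.pt ∉ S}
    have hfin : ((univ : Set (ComplexPoints X)) \ V).Finite := by
      refine (finite_setOf_pt_mem (X := X) hS).subset fun P hP ↦ ?_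
      have hP' : P ∉ V := hP.2
      simp only [V, mem_setOf_eq, not_not] at hP'
      exact hP'
    have h1 := map_inclusion_surjective_of_finite_diff (d := 2 * n) (by omega) isOpen_univ
      (subset_univ V) hfin (by omega) hkn'
    have h2 : Function.Surjective (singularCohomology.map ℤ ℤ
        ((Homeomorph.Set.univ (ComplexPoints X) : C(↥(univ : Set (ComplexPoints X)),
          ComplexPoints X))) k) :=
      ((forget (ModuleCat ℤ)).mapIso
        (singularCohomology.mapIso ℤ ℤ (Homeomorph.Set.univ (ComplexPoints X)) k)).toEquiv.surjective
    have hcomp : restrictComplInt X S k = singularCohomology.map ℤ ℤ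
        (((Homeomorph.Set.univ (ComplexPoints X) : C(↥(univ : Set (ComplexPoints X)),
          ComplexPoints X))).comp (ContinuousMap.inclusion (subset_univ V))) k := by
      rw [restrictComplInt]; rfl
    have hsurj : Function.Surjective (singularCohomology.map ℤ ℤ
        (((Homeomorph.Set.univ (ComplexPoints X) : C(↥(univ : Set (ComplexPoints X)),
          ComplexPoints X))).comp (ContinuousMap.inclusion (subset_univ V))) k) := by
      rw [singularCohomology.map_comp]
      exact h1.comp h2
    rw [hcomp]
    exact hsurj

/-- **Kollár (1992), the lattice step from the curve-wise kernel bound.** Let `X/ℂ` be a smooth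
projective threefold, `α ∈ H⁴(X(ℂ); ℤ)` non-torsion, `p ≥ 2`, `D > 0`, such that
(i') for every irreducible closed curve `C ⊆ X` (all points of codimension `≥ 2`, some point of
codimension `2`), every class dying on `(X ∖ C)(ℂ)` is an integral multiple of `p • α` — in print:
"`H⁴(X, ℤ) = ℤα`", the class of `C` is `(deg C) α` [cite: SouleVoisin2005, §2], purity
`H⁴_C(X; ℤ) = ℤ · cl(C)` [cite: Fulton1998, §19.1 Lemma 19.1.1], and "for general `X`, any curve
`C ⊂ X` has degree divisible by `p`" [cite: SouleVoisin2005, §2 Thm. 2]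
[cite: KollarTrento1992, §1 Lemma p. 134 and Example p. 135] — and (ii) `D • α` dies off some
closed subset of codimension `≥ 2` (the plane section). Then
`Kollar1992_nonTorsionClass_notAlgebraic` (the tree's `…_of_ker_le_span`, its hypothesis (i) for
ALL closed `Z` of codimension `≥ 2` being supplied by
`ker_restrictComplInt_le_of_forall_isIrreducible`). -/
theorem Kollar1992_nonTorsionClass_notAlgebraic_of_ker_le_span_of_curves
    (hX : IsSmoothProjective 3 X) {α : bettiCohomologyInt X (2 * 2)}
    (hα : ∀ m : ℤ, m • α = 0 → m = 0) {p : ℕ} (hp : 2 ≤ p)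
    (hker : ∀ C : Set X.left, IsClosed C → IsIrreducible C →
      (∀ z ∈ C, ((2 : ℕ) : ℕ∞) ≤ Order.coheight z) → (∃ z ∈ C, Order.coheight z = (2 : ℕ)) →
        LinearMap.ker (restrictComplInt X C (2 * 2)).hom ≤ Submodule.span ℤ {(p : ℤ) • α})
    {D : ℕ} (hD : 0 < D)
    (hplane : ∃ Z : Set X.left, IsClosed Z ∧ (∀ z ∈ Z, ((2 : ℕ) : ℕ∞) ≤ Order.coheight z) ∧
      restrictComplInt X Z (2 * 2) ((D : ℤ) • α) = 0) :
    Kollar1992_nonTorsionClass_notAlgebraic :=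
  Kollar1992_nonTorsionClass_notAlgebraic_of_ker_le_span hX hα hp
    (fun _ hZ hZ2 ↦ ker_restrictComplInt_le_of_forall_isIrreducible (r := 2) hX (by norm_num)
      (by norm_num) (by norm_num) hker hZ hZ2) hD hplane

/-- The same, unpacked: under (i') and (ii) the barrier's conclusion for `X, α, D` — `α` is not an
integral algebraic class while `D • α` is. [cite: SouleVoisin2005, §2 Thm. 2]
[cite: KollarTrento1992, §1 Lemma p. 134 and Example p. 135] -/
theorem not_mem_integralAlgebraicClasses_of_curves (hX : IsSmoothProjective 3 X)
    {α : bettiCohomologyInt X (2 * 2)} (hα : ∀ m : ℤ, m • α = 0 → m = 0) {p : ℕ} (hp : 2 ≤ p)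
    (hker : ∀ C : Set X.left, IsClosed C → IsIrreducible C →
      (∀ z ∈ C, ((2 : ℕ) : ℕ∞) ≤ Order.coheight z) → (∃ z ∈ C, Order.coheight z = (2 : ℕ)) →
        LinearMap.ker (restrictComplInt X C (2 * 2)).hom ≤ Submodule.span ℤ {(p : ℤ) • α}) :
    α ∉ integralAlgebraicClasses X 2 :=
  not_mem_integralAlgebraicClasses_of_ker_le_span hα hp fun _ hZ hZ2 ↦
    ker_restrictComplInt_le_of_forall_isIrreducible (r := 2) hX (by norm_num) (by norm_num)
      (by norm_num) hker hZ hZ2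


/-! ### The smooth locus of a curve is the complement of finitely many closed points -/

section SmoothLocus

/-- **A closed subvariety of dimension `≤ 1` on a smooth projective variety over `ℂ` is smooth
over `ℂ` outside finitely many closed points.** Let `X` be smooth projective of dimension `r + 1`
and `W ⊆ X` a closed subvariety (integral closed subscheme, `Motives.ClosedSubvariety`) all of whose
points have codimension `≥ r` in `X` (`X → Spec ℂ` locally of finite type, as follows from `hX`; an
instance argument so that the smooth locus can be named). Then the image in `X` of the complement of
the smooth locus of `W → Spec ℂ` (Mathlib's `Scheme.Hom.smoothLocus`, an open subset of `W`) is a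
finite set of closed points: the smooth locus contains the generic point of `W` (`ℂ` is perfect; Mathlib's
`Scheme.Hom.genericPoint_mem_smoothLocus_of_perfectField` — generic smoothness, Hartshorne III
Cor. 10.7 / II Cor. 8.16), so its complement is a proper closed subset of the irreducible curve
`W`, i.e. finitely many closed points (`finite_of_isClosed_of_genericPoint_notMem`). Together with
`ComplexPoints.isConnected_setOf_pt_mem_diff_of_isIrreducible` (an irreducible curve minus finitely
many closed points has a connected set of complex points) this is the algebraic input for reading
the class of an irreducible curve `C` off its smooth locus `C ∖ Sing C ⊆ (X ∖ Sing C)(ℂ)`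
(`restrictComplInt_bijective_of_finite`). [cite: Hartshorne1977, III Cor. 10.7 and II Cor. 8.16]
[cite: Hartshorne1977, I Prop. 1.5 and II Ex. 3.20 (d)] -/
theorem finite_image_compl_smoothLocus {r : ℕ} (hX : IsSmoothProjective (r + 1) X)
    [LocallyOfFiniteType X.hom] (W : ClosedSubvariety X.left)
    (hW : ∀ z ∈ Set.range W.ι.base, (r : ℕ∞) ≤ Order.coheight z) :
    (W.ι.base '' ((W.ι ≫ X.hom).smoothLocus : Set W.carrier)ᶜ).Finite ∧
      ∀ z ∈ W.ι.base '' ((W.ι ≫ X.hom).smoothLocus : Set W.carrier)ᶜ,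
        IsClosed ({z} : Set X.left) := by
  -- the closed irreducible subset `C = W(⊆ X)` and its generic point
  have hCc : IsClosed (Set.range W.ι.base) := W.ι.isClosedEmbedding.isClosed_range
  have hCi : IsIrreducible (Set.range W.ι.base) := by
    rw [← Set.image_univ]
    exact (IrreducibleSpace.isIrreducible_univ (X := W.carrier)).image _
      W.ι.continuous.continuousOn
  have hgenW : IsGenericPoint W.genericPoint (Set.range W.ι.base) := by
    have h1 : closure ({W.genericPoint} : Set X.left) =
        W.ι.base '' closure {genericPoint W.carrier} := by
      rw [ClosedSubvariety.genericPoint, ← Set.image_singleton,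
        W.ι.isClosedEmbedding.closure_image_eq]
    rw [IsGenericPoint, h1, (genericPoint_spec W.carrier).def, Set.image_univ]
  have hgen : hCi.genericPoint = W.genericPoint :=
    (hCi.isGenericPoint_genericPoint hCc).eq hgenW
  -- the non-smooth locus `D` misses the generic point and is closed
  set D : Set X.left := W.ι.base '' ((W.ι ≫ X.hom).smoothLocus : Set W.carrier)ᶜ with hD
  have hDc : IsClosed D :=
    W.ι.isClosedEmbedding.isClosedMap _ (isClosed_compl_iff.mpr (W.ι ≫ X.hom).smoothLocus.isOpen)
  have hDC : D ⊆ Set.range W.ι.base := by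
    rintro _ ⟨w, -, rfl⟩
    exact ⟨w, rfl⟩
  have hξ : genericPoint W.carrier ∈ (W.ι ≫ X.hom).smoothLocus :=
    (W.ι ≫ X.hom).genericPoint_mem_smoothLocus_of_perfectField
  have hgenD : hCi.genericPoint ∉ D := by
    rw [hgen]
    rintro ⟨w, hw, hw'⟩
    have hww : w = genericPoint W.carrier := W.ι_base_injective hw'
    exact hw (hww ▸ hξ)
  refine ⟨finite_of_isClosed_of_genericPoint_notMem hX hCi hCc hW hDc hDC hgenD, fun z hz ↦ ?_⟩
  exact isClosed_singleton_of_ne_genericPoint hX hCi hCc hW (hDC hz) fun h ↦ hgenD (h ▸ hz)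

end SmoothLocus


/-! ### The joint frontier: homological Lefschetz + the curve-wise kernel bound -/

section Frontier

open Literature.AlgebraicGeometry.Motives.SmoothHypersurface

/-- **Kollár (1992) for `X_F ⊆ ℙ⁴_ℂ`: the current frontier of the two lines of attack in one
statement.** Combining the tree's `Kollar1992_nonTorsionClass_notAlgebraic_of_lefschetzH2` (the
plane-section input (d) reduced to the Lefschetz theorem on hyperplane sections in homology, the
non-vanishing of the fundamental class `ι_! 1`, and a generator of `H²(ℙ⁴(ℂ); ℤ)`) with
`ker_restrictComplInt_le_of_forall_isIrreducible` (the kernel bound (i) reduced to irreducible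
curves): for a form `F ∈ ℂ[x₀, …, x₄]` with `X_F` a smooth projective threefold and `F ∉ (xᵢ, xⱼ)`,
`ℤ`-orientations `μ_X`, `μ_ℙ`, a generator `c` of `H²(ℙ⁴(ℂ); ℤ)`, IF (deg') `ι_! 1 ≠ 0`
[cite: VoisinHodgeII2003, §1.2.2 Rem. 1.26], (L) `ι(ℂ)_* : H₂(X_F(ℂ); ℤ) → H₂(ℙ⁴(ℂ); ℤ)` is
bijective [cite: VoisinHodgeII2003, §1.2.2 Thm. 1.23], and (i') for the class `α` with
`ι_! α = c² ∪ c` and some `p ≥ 2`, every class dying off an IRREDUCIBLE CURVE `C ⊆ X_F` is an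
integral multiple of `p • α` — purity for one curve, `cl(C) = (deg C) α`
[cite: Fulton1998, §19.1 Lemma 19.1.1] [cite: SouleVoisin2005, §2], and Kollár's "any curve
`C ⊂ X` has degree divisible by `p`" for the very general `X` of degree `p²` (resp. `p³ ∣ D`)
[cite: KollarTrento1992, §1 Lemma p. 134 and Example p. 135] [cite: SouleVoisin2005, §2 Thm. 2] —
THEN `Kollar1992_nonTorsionClass_notAlgebraic`. Nothing else of the printed proof remains. -/
theorem Kollar1992_nonTorsionClass_notAlgebraic_of_lefschetzH2_of_curves
    {F : MvPolynomial (Fin (3 + 2)) ℂ} (hXF : IsSmoothProjective 3 (hypersurface F))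
    {i j : Fin (3 + 2)} (hij : i ≠ j)
    (hF : F ∉ Ideal.span (MvPolynomial.X '' {i, j} : Set (MvPolynomial (Fin (3 + 2)) ℂ)))
    (μX : HomologicalOrientation ℤ (ComplexPoints (hypersurface F)) 6)
    (μP : HomologicalOrientation ℤ (ComplexPoints (projectiveSpace 4 ℂ)) 8)
    (c : bettiCohomologyInt (projectiveSpace 4 ℂ) 2)
    (hgen : Function.Bijective
      (LinearMap.toSpanSingleton ℤ (bettiCohomologyInt (projectiveSpace 4 ℂ) 2) c))
    (h1 : gysinMap μX μP (AlgPoints.mapContinuous (L := ℂ) (hypersurfaceι F)) (Nat.zero_add 6)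
      (show 2 + 6 = 8 from rfl) (singularCohomology.one ℤ (ComplexPoints (hypersurface F))) ≠ 0)
    (hL : Function.Bijective
      (singularHomology.map ℤ ℤ (AlgPoints.mapContinuous (L := ℂ) (hypersurfaceι F)) 2))
    {p : ℕ} (hp : 2 ≤ p)
    (hker : ∀ α : bettiCohomologyInt (hypersurface F) (2 * 2),
      gysinMap μX μP (AlgPoints.mapContinuous (L := ℂ) (hypersurfaceι F))
          (show 2 * 2 + 2 = 6 from rfl) (show 6 + 2 = 8 from rfl) α =
        cupProduct (show 4 + 2 = 6 from rfl) (cupProduct (show 2 + 2 = 4 from rfl) c c) c →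
      ∀ C : Set (hypersurface F).left, IsClosed C → IsIrreducible C →
        (∀ z ∈ C, ((2 : ℕ) : ℕ∞) ≤ Order.coheight z) → (∃ z ∈ C, Order.coheight z = (2 : ℕ)) →
          LinearMap.ker (restrictComplInt (hypersurface F) C (2 * 2)).hom ≤
            Submodule.span ℤ {(p : ℤ) • α}) :
    Kollar1992_nonTorsionClass_notAlgebraic :=
  Kollar1992_nonTorsionClass_notAlgebraic_of_lefschetzH2 hXF hij hF μX μP c hgen h1 hL hp
    fun α hα _ hZ hZ2 ↦ ker_restrictComplInt_le_of_forall_isIrreducible (r := 2) hXF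
      (by norm_num) (by norm_num) (by norm_num) (hker α hα) hZ hZ2

end Frontier

end HodgeConjecture
end Barriers

end Literature.Barriers.HodgeConjecture

end
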